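import Summits.AtomisticToContinuum.HydrodynamicLimit.Theses.OneSphereInfluence
import Summits.AtomisticToContinuum.HydrodynamicLimit.Theorems.StiffCollisionalRelaxationAprioriBoundsFibreDefs
import Summits.AtomisticToContinuum.HydrodynamicLimit.Theorems.StiffCollisionalRelaxationAprioriBoundsFibreDefsR4

/-!
# Sketch for the line `tail-occupation-variance` (crux `AprioriBounds`, stmt-AtomisticToContinuum-14827):
the Efron–Stein PRODUCER of the new stub `stub_occupationVariance` typechecks against the tree

Planner material (crux-strategist planner-cstrat-stmt-AtomisticToContinuum-14827-s1-0), kernel-checked, NOT part of the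
registered skeleton (a skeleton may only bind registered stubs).  It shows that the new open stub of the line docks onto
the EXISTING statics item `OneSphereInfluence.HardCorePoincare` (stmt-AtomisticToContinuum-13619) plus ONE dynamical
statement of the shape of `OneSphereInfluence.ResamplingInfluence` (stmt-13618) written for the time-integrated tail
occupation `occ_K = ∫₀ᵗ frac_K(Φ_s ·) ds` instead of the time-`t` conserved fields:

* `variance_tendsto_zero_of_efronStein` — abstract squeeze: an Efron–Stein/Poincaré inequality with constant `C` for the
  laws `P N` + vanishing one-coordinate influence sums of the observables `X N` ⟹ `Var_{P N}(X N) → 0`.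
* `occupationVariance_of_hardCorePoincare` — instantiated BY NAME: `HardCorePoincare` + the influence statement for `occ_K`
  (+ `MemLp`, which holds since `0 ≤ occ_K ≤ t`; left as a hypothesis here) give the conclusion of `stub_occupationVariance`
  at every `σ` below `HardCorePoincare`'s threshold, for every flow family and every level `K`.
-/

noncomputable section

open MeasureTheory ProbabilityTheory Filter Set Topology
open scoped ENNReal

namespace Summit.AtomisticToContinuum.HydrodynamicLimit.Cruxes.AprioriBounds.TailOccupationVariance.Sketch

open Literature.MathematicalPhysics.KineticTheory Literature.Analysis.FluidPDE
open Summit.AtomisticToContinuum.HydrodynamicLimit.Theorems.VisitLedgerUpscattering (Cfg Flow Flows NiceProfiles)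
open Summit.AtomisticToContinuum.HydrodynamicLimit.Theorems.FibreDeficitTransfer
open Summit.AtomisticToContinuum.HydrodynamicLimit.Theses.OneSphereInfluence (HardCorePoincare)

/-- Abstract squeeze: Efron–Stein/Poincaré with constant `C` + vanishing influence sums ⟹ vanishing variances. -/
theorem variance_tendsto_zero_of_efronStein {Ω : ℕ → Type*} [∀ N, MeasurableSpace (Ω N)]
    (P : (N : ℕ) → Measure (Ω N)) (X : (N : ℕ) → Ω N → ℝ) (D : ℕ → ℝ) (C : ℝ)
    (hES : ∀ N, variance (X N) (P N) ≤ C * D N) (hD : Tendsto D atTop (𝓝 0)) :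
    Tendsto (fun N => variance (X N) (P N)) atTop (𝓝 0) := by
  refine squeeze_zero (fun N => variance_nonneg (X N) (P N)) hES ?_
  simpa using hD.const_mul C

/-- **The dock, by name.**  `HardCorePoincare` (stmt-13619) + the one-sphere resampling influence of the time-integrated
tail occupations (the stmt-13618 statement for the observable `occ_K`) ⟹ the conclusion of `stub_occupationVariance`
(for all `σ` below `HardCorePoincare`'s threshold, every flow family, every horizon `t`, every level `K`). -/
theorem occupationVariance_of_hardCorePoincare (hP : HardCorePoincare)
    {a₀ θ₀ : T3 → ℝ} {u₀ : T3 → V3} (hprof : NiceProfiles a₀ θ₀ u₀) :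
    ∃ σ₀ : ℝ, 0 < σ₀ ∧ ∀ σ : ℝ, 0 < σ → σ < σ₀ →
      ∀ (Φ : (N : ℕ) → HardSphereFlow (Torus.geometry (Fin 3)) (hsDiameter σ N) (N + 1)) (t : ℝ) (K : ℝ),
        -- `MemLp` of the occupation (true: measurable and bounded by `t`; the prover's obligation)
        (∀ N : ℕ, MemLp (fun z => (∫⁻ s in Icc 0 t, ENNReal.ofReal (frac K ((Φ N).flow s z))).toReal) 2
          (localGibbsLaw σ a₀ u₀ θ₀ N (Φ N))) →
        -- ONE-SPHERE RESAMPLING INFLUENCE of the occupation (the dynamical input, shape of stmt-13618)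
        Tendsto (fun N : ℕ => ∑ i : Fin (N + 1), ∫ z, condVar
            (MeasurableSpace.comap (fun (z : Config (N + 1) (Fin 3) T3) (j : Fin N) => z (i.succAbove j))
              MeasurableSpace.pi)
            (fun z => (∫⁻ s in Icc 0 t, ENNReal.ofReal (frac K ((Φ N).flow s z))).toReal)
            (localGibbsLaw σ a₀ u₀ θ₀ N (Φ N)) z ∂(localGibbsLaw σ a₀ u₀ θ₀ N (Φ N))) atTop (𝓝 0) →
        Tendsto (fun N : ℕ => variance
            (fun z => (∫⁻ s in Icc 0 t, ENNReal.ofReal (frac K ((Φ N).flow s z))).toReal)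
            (localGibbsLaw σ a₀ u₀ θ₀ N (Φ N))) atTop (𝓝 0) := by
  obtain ⟨ha, hθ, hu, ha0, hθ0⟩ := hprof
  obtain ⟨σ₀, hσ₀, H⟩ := hP a₀ θ₀ u₀ ha hθ hu ha0 hθ0
  refine ⟨σ₀, hσ₀, fun σ hσ hσlt Φ t K hmem hinf => ?_⟩
  obtain ⟨C, hC, hES⟩ := H σ hσ hσlt
  exact variance_tendsto_zero_of_efronStein (fun N => localGibbsLaw σ a₀ u₀ θ₀ N (Φ N))
    (fun N z => (∫⁻ s in Icc 0 t, ENNReal.ofReal (frac K ((Φ N).flow s z))).toReal) _ C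
    (fun N => hES N (Φ N) _ (hmem N)) hinf

end Summit.AtomisticToContinuum.HydrodynamicLimit.Cruxes.AprioriBounds.TailOccupationVariance.Sketch

end
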